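import Summits.BirchSwinnertonDyer.BirchSwinnertonDyer.Theorems.TwoAdicConverseMultEisensteinPrint
import Summits.BirchSwinnertonDyer.BirchSwinnertonDyer.Theorems.ByReductionTypeAtTwoMultTowerControl
import HarnessLib

/-!
# Route `TwoAdicConverse`, crux `MultiplicativeRankZeroTwoConverse` / served crux `MultTwoConverseOverKAtTwo` (item
# stmt-BirchSwinnertonDyer-19187), the integral cyclotomic road at a multiplicative `2`: the PRINT binder
# `h15 = Greenberg1999.thm15_isTorsion_multiplicative_rat` (Thm. 1.5, Kato–Rohrlich) STRUCK — on the finite-`Sel` locus of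
# the `2`-converse, «`X(E/ℚ_∞)` is `Λ`-torsion» is a KERNEL theorem (Prop. 3.7 at a multiplicative prime + Thm. 1.4)

HONEST FRAMING (cell `bsd-2adic`, run/shared/lean/pub/bsd-2adic/, seat `bsd-2adic-tower-1` GEN 28, HUMAN RULINGS
D-0036 / D-0054 / D-0074 / D-0152): theorems only (no definition, no named fact, no `sorry`); no class booked; no display
re-keyed; PARTITION (D-0054): none — RANK axis (S3 mult); companion formula cell X5@2 mult (K4ᵐ). BSD is not proved by any
of this. `TwoAdicConverseMultEisensteinPrint.lean` (mult seat) re-assembled the integral cyclotomic road on PRINT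
{A235-twin `h41ns`, A236 `h41sp`, modularity, Greenberg Thm. 1.5 `h15`} + MEMO {Greenberg–Stevens at a split `2`} + the
∀-closed object T-mult-4-int, using `h15` for ONE thing: «`X(E/ℚ_∞)` is `Λ`-torsion» at a curve multiplicative at `2`
(`isTorsion_two_of_thm15`). On THIS road the curve carries `corank_{ℤ₂} Sel_{2^∞}(E/ℚ) = 0`, i.e. `Sel_{2^∞}(E/ℚ)` FINITE
— and «finite `Sel` ⇒ `X` torsion» at a multiplicative prime is Greenberg's Thm. 1.4 there, now a KERNEL theorem of this seat
(GEN 28 `MultTowerControl.isFG_and_isTorsion_of_finite_selmerGroup_multiplicative`: Prop. 3.7 = the control theorem at a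
multiplicative `p`, every `p`, + «`X/TX` finite ⇒ torsion»; Greenberg p. 96). So `h15` leaves the road entirely:

* `isTorsion_two_of_finite_selmer_mult` — the torsion binder `hX` of the per-curve theorems from `Finite (Sel_{2^∞}(E/ℚ))`
  ALONE (no modularity, no newform, no Kato, no GZK);
* `analyticRank_eq_zero_of_selmerCorank_eq_zero_nonsplit_two_of_multEisenstein_control` — the non-split per-curve theorem
  (`…_print` with `hXD` from the kernel; proof otherwise verbatim, guarded twin `h41`);
* `nonsplitMultRankZeroTwoConverse_of_multEisenstein_control`, `splitMultRankZeroTwoConverse_of_multEisenstein_of_greenbergStevens_control`,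
  `multiplicativeRankZeroTwoConverse_of_bySign_control`, `multiplicativeRankZeroTwoConverse_of_multEisenstein_of_control`,
  `…_of_control_upToIsogeny` — the ∀-closed bridges with `h15` STRUCK: PRINT {`h41ns`, `h41sp`, `hmod`} + MEMO {`hGS`,
  split only} + the object;
* `multTwoConverseOverKAtTwo_of_multEisenstein_of_control` — the SERVED crux 19187 by name on the same inputs (the 4th
  conjunct «Thm. 1.5» of the line's PUB pack is no longer consumed).

What this is NOT: a proof of the crux (T-mult-4-int is open); the named fact `thm15_isTorsion_multiplicative_rat` itself (any
rank, Kato Thm. 14.2 + Rohrlich) is NOT proved — only its use on the finite-`Sel` locus is replaced by kernel.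

References: R. Greenberg, LNM 1716 (1999), Thm. 1.4/1.5 (pp. 60–61), §3 Prop. 3.7 (p. 94), §4 pp. 96, 112–113;
B. Mazur, J. Tate, J. Teitelbaum, Invent. Math. 84 (1986), §I.14, §II.10.
-/

set_option autoImplicit false
-- the Theorems namespace of this sub repeats the summit name by design (D-0017 nested layout: Summit.<S>.<Sub>)
set_option linter.dupNamespace false

noncomputable section

open scoped Classical MatrixGroups ModularForm

open CongruenceSubgroup WeierstrassCurve Literature.NumberTheory.EllipticCurves
  Literature.NumberTheory.EllipticCurves.ModularForms
  Literature.NumberTheory.EllipticCurves.Greenberg1999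
  Literature.NumberTheory.EllipticCurves.Rank1Residual
  Literature.NumberTheory.EllipticCurves.Rank1Residual.Typed
  Summit.BirchSwinnertonDyer.Rank1Residual.X5
  Summit.BirchSwinnertonDyer.Rank1Residual.X5.O1
  Summit.BirchSwinnertonDyer.BirchSwinnertonDyer.Theses.TwoAdicConverse

namespace Summit.BirchSwinnertonDyer.BirchSwinnertonDyer.Theorems

/-! ## §1 Per curve -/

section PerCurve

variable (W : WeierstrassCurve ℚ) [W.IsElliptic] [W.IsGloballyMinimal]

/-- **«`X(E/ℚ_∞)` is `Λ`-torsion» at a multiplicative `2` from `Finite (Sel_{2^∞}(E/ℚ))` ALONE — KERNEL** (no modularity,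
no Kato, no GZK): exactly the binder `hX` of the per-curve theorems
`analyticRank_eq_zero_of_finite_selmer_{nonsplit,split}_two_of_multEisenstein`, supplied by Greenberg's Thm. 1.4 at a
multiplicative prime (`MultTowerControl.isFG_and_isTorsion_of_finite_selmerGroup_multiplicative`: control Prop. 3.7 + «`X/TX`
finite ⇒ torsion»). The cyclotomic-variable normalisation of `γ` is not needed and is discarded.
[cite: GreenbergLNM1716, Thm 1.4 (p. 60), §3 Prop. 3.7 (p. 94), §4 p. 96] -/
theorem isTorsion_two_of_finite_selmer_mult (hmult : Mult W 2) (hfin : Finite (W.selmerGroupPInfty 2)) :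
    ∀ (κ : ZpExtension ℚ 2) (γ : Field.absoluteGaloisGroup ℚ), κ.IsCyclotomic →
      κ.IsTopGenerator γ → IsCyclotomicVariable 2 γ → ∀ D : W.SelmerDualData κ γ, D.IsTorsion :=
  fun κ _ hκ hγ _ D ↦ (MultTowerControl.isFG_and_isTorsion_of_finite_selmerGroup_multiplicative W hmult κ hκ hγ D hfin).2

/-- **Rank-`0` `2`-converse at a NON-SPLIT multiplicative `2`, inputs PRINT {guarded twin `h41`, modularity} + the object —
`h15`-FREE.** `E/ℚ` (globally minimal `W`) non-split multiplicative at `2`, `corank_{ℤ₂} Sel_{2^∞}(E/ℚ) = 0`, the integral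
Eisenstein direction `O1.MultEisensteinDivisibilityAtTwo W` ⟹ `L(E,1) ≠ 0` and `r_an(E) = 0`. The proof of
`…_nonsplit_two_of_multEisenstein_print` verbatim, with the torsion of `X` from `isTorsion_two_of_finite_selmer_mult`.
[cite: GreenbergLNM1716, §4 pp. 112–113, Thm 1.4 and §3 Prop. 3.7] [cite: MazurTateTeitelbaum1986Invent, §I.14 (L(0) = (1 − α⁻¹)[0]⁺, α = −1)] -/
theorem analyticRank_eq_zero_of_selmerCorank_eq_zero_nonsplit_two_of_multEisenstein_control
    (h41 : thm41Analogue_charValue_rankZero_numberField_anyPrime_oddLocalDegree)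
    (hmod : nonempty_modularParametrizationData) (hEis : MultEisensteinDivisibilityAtTwo W)
    (hmult : Mult W 2) (hns : ¬ W.HasSplitMultiplicativeReductionAtPrime 2)
    (hsel : W.selmerCorank 2 = 0) :
    W.entireLFunction 1 ≠ 0 ∧ W.analyticRank = 0 := by
  have hfin : Finite (W.selmerGroupPInfty 2) :=
    (finite_selmerGroupPInfty_iff_selmerCorank_eq_zero W 2).mpr hsel
  haveI : NeZero (W.conductorNorm ℤ) := ⟨(W.conductorNorm_pos_holds).ne'⟩
  obtain ⟨Dm⟩ := hmod W
  have hf : IsNewformOf W Dm.f := Dm.isNewformOf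
  obtain ⟨ϖ, hϖpos, hϖ, -⟩ := Dm.exists_rat_mul_realPeriodRat_eq_plusPeriod
  obtain ⟨κ, hκ, γ, hγ, hγ'⟩ := exists_isCyclotomic_isTopGenerator_isCyclotomicVariable_holds 2
  obtain ⟨D⟩ := W.nonempty_selmerDualData_holds κ γ hγ
  obtain ⟨L, hL⟩ := exists_isMultPAdicLFunctionOf_neg_one_of_nonsplit (p := 2) hf hmult hns
  have hXD : D.IsTorsion := isTorsion_two_of_finite_selmer_mult W hmult hfin κ γ hκ hγ hγ' D
  haveI : Module.Finite (IwasawaAlgebra 2) D.X := D.module_finite_holds hγ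
  haveI : (Module.charIdeal (IwasawaAlgebra 2) D.X).IsPrincipal := charIdeal_isPrincipal_holds 2 D.X
  obtain ⟨fE, hchar⟩ := Submodule.IsPrincipal.principal (Module.charIdeal (IwasawaAlgebra 2) D.X)
  have hchar' : D.charIdeal = Ideal.span {fE} := hchar
  -- Greenberg's non-split display at `2` (guarded twin, primed glue): `f_E(0) ≠ 0` since `Sel` is finite
  have hEC : TwoAdicEulerCharRankZeroNonsplitMult W 0 :=
    twoAdicEulerCharRankZeroNonsplitMult_zero_of_greenberg' W h41
  obtain ⟨u, hu⟩ := hEC hmult hns κ γ hκ hγ hγ' D hXD fE hchar' hfin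
  have hcard : (Nat.card (W.selmerGroupPInfty 2) : ℚ_[2]) ≠ 0 := by
    haveI := hfin
    exact_mod_cast (Nat.card_pos (α := W.selmerGroupPInfty 2)).ne'
  have hfE0 : ((PowerSeries.constantCoeff fE : ℤ_[2]) : ℚ_[2]) ≠ 0 := by
    intro h0
    rw [h0, zero_mul] at hu
    exact (mul_ne_zero (mul_ne_zero (coe_units_ne_zero 2 u) (zpow_ne_zero _ two_ne_zero)) hcard)
      hu.symm
  -- T-mult-4-int, non-split clause at `(Dm.f, ϖ)`: `ι f_E = ι h · (ϖ · L)`, constant coefficients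
  obtain ⟨hns', -⟩ := hEis κ γ hκ hγ hγ' hmult Dm.f hf ϖ hϖ D fE hchar'
  obtain ⟨h, hdiv⟩ := hns' hns L hL
  have h0 := congrArg PowerSeries.constantCoeff hdiv
  rw [map_mul, map_mul, PowerSeries.constantCoeff_C, constantCoeff_iwasawaToPowerSeries,
    constantCoeff_iwasawaToPowerSeries, hL.constantCoeff_of_neg_one] at h0
  -- `f_E(0) = h(0) · (ϖ · (2 · [0]⁺_f))`, so `[0]⁺_f ≠ 0`
  have hs0 : (ratPlusSymbol Dm.f 0 : ℚ_[2]) ≠ 0 := by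
    intro hz
    rw [hz, mul_zero, mul_zero, mul_zero] at h0
    exact hfE0 h0
  have hs0' : ratPlusSymbol Dm.f 0 ≠ 0 := by exact_mod_cast hs0
  have hL1 : W.entireLFunction 1 ≠ 0 := (ratPlusSymbol_zero_ne_zero_iff W hf).mp hs0'
  exact ⟨hL1, (W.analyticRank_eq_zero_iff_holds hf.hasEntireLFunction).mpr hL1⟩

end PerCurve

/-! ## §2 The ∀-closed bridges WITHOUT `h15` -/

/-- **The NON-SPLIT half of the crux from PRINT {A235-twin `h41ns`, modularity} + the object — `h15`-FREE.**
[cite: GreenbergLNM1716, §4 pp. 112–113, Thm 1.4, §3 Prop. 3.7] [cite: MazurTateTeitelbaum1986Invent, §I.14] -/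
theorem nonsplitMultRankZeroTwoConverse_of_multEisenstein_control
    (h41ns : thm41Analogue_charValue_rankZero_numberField_anyPrime_oddLocalDegree)
    (hmod : nonempty_modularParametrizationData)
    (hEis : ∀ (W : WeierstrassCurve ℚ) [W.IsElliptic] [W.IsGloballyMinimal],
      ¬ W.HasCM → Mult W 2 → ¬ W.HasSplitMultiplicativeReductionAtPrime 2 →
        MultEisensteinDivisibilityAtTwo W) :
    ∀ (W : WeierstrassCurve ℚ) [W.IsElliptic] [W.IsGloballyMinimal], ¬ W.HasCM → Mult W 2 →
      ¬ W.HasSplitMultiplicativeReductionAtPrime 2 → W.selmerCorank 2 = 0 → W.analyticRank = 0 :=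
  fun W _ _ hcm hmult hns hsel =>
    (analyticRank_eq_zero_of_selmerCorank_eq_zero_nonsplit_two_of_multEisenstein_control W h41ns hmod
      (hEis W hcm hmult hns) hmult hns hsel).2

/-- **The SPLIT half of the crux from PRINT {A236 `h41sp`, modularity} + MEMO {Greenberg–Stevens at `2`} + the object —
`h15`-FREE** (p418740's per-curve theorem with the torsion binder from `isTorsion_two_of_finite_selmer_mult`).
[cite: GreenbergLNM1716, §4 pp. 112–113, Thm 1.4, §3 Prop. 3.7] [cite: MazurTateTeitelbaum1986Invent, §II.10] -/
theorem splitMultRankZeroTwoConverse_of_multEisenstein_of_greenbergStevens_control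
    (h41sp : thm41Analogue_charValue_rankZero_split_baseChange_anyPrime)
    (hmod : nonempty_modularParametrizationData)
    (hGS : ∀ (W : WeierstrassCurve ℚ) [W.IsElliptic] [W.IsGloballyMinimal],
      W.HasSplitMultiplicativeReductionAtPrime 2 → greenberg_stevens (W := W) (p := 2))
    (hEis : ∀ (W : WeierstrassCurve ℚ) [W.IsElliptic] [W.IsGloballyMinimal],
      ¬ W.HasCM → Mult W 2 → W.HasSplitMultiplicativeReductionAtPrime 2 →
        MultEisensteinDivisibilityAtTwo W) :
    ∀ (W : WeierstrassCurve ℚ) [W.IsElliptic] [W.IsGloballyMinimal], ¬ W.HasCM → Mult W 2 →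
      W.HasSplitMultiplicativeReductionAtPrime 2 → W.selmerCorank 2 = 0 → W.analyticRank = 0 := by
  intro W _ _ hcm hmult hsp hsel
  have hfin : Finite (W.selmerGroupPInfty 2) :=
    (finite_selmerGroupPInfty_iff_selmerCorank_eq_zero W 2).mpr hsel
  exact (analyticRank_eq_zero_of_finite_selmer_split_two_of_multEisenstein W (hGS W hsp) h41sp hmod
    (isTorsion_two_of_finite_selmer_mult W hmult hfin) (hEis W hcm hmult hsp) hmult hsp hfin).2

/-- **The crux assembled BY SIGN, `h15`-FREE**: PRINT {`h41ns`, `h41sp`, `hmod`} + MEMO {`hGS`, split only} + the object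
asked for sign by sign. [cite: GreenbergLNM1716, §4 pp. 112–113, Thm 1.4, §3 Prop. 3.7] -/
theorem multiplicativeRankZeroTwoConverse_of_bySign_control
    (h41ns : thm41Analogue_charValue_rankZero_numberField_anyPrime_oddLocalDegree)
    (h41sp : thm41Analogue_charValue_rankZero_split_baseChange_anyPrime)
    (hmod : nonempty_modularParametrizationData)
    (hGS : ∀ (W : WeierstrassCurve ℚ) [W.IsElliptic] [W.IsGloballyMinimal],
      W.HasSplitMultiplicativeReductionAtPrime 2 → greenberg_stevens (W := W) (p := 2))
    (hEns : ∀ (W : WeierstrassCurve ℚ) [W.IsElliptic] [W.IsGloballyMinimal],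
      ¬ W.HasCM → Mult W 2 → ¬ W.HasSplitMultiplicativeReductionAtPrime 2 →
        MultEisensteinDivisibilityAtTwo W)
    (hEsp : ∀ (W : WeierstrassCurve ℚ) [W.IsElliptic] [W.IsGloballyMinimal],
      ¬ W.HasCM → Mult W 2 → W.HasSplitMultiplicativeReductionAtPrime 2 →
        MultEisensteinDivisibilityAtTwo W) :
    MultiplicativeRankZeroTwoConverse :=
  multiplicativeRankZeroTwoConverse_iff_bySign.mpr
    ⟨nonsplitMultRankZeroTwoConverse_of_multEisenstein_control h41ns hmod hEns,
      splitMultRankZeroTwoConverse_of_multEisenstein_of_greenbergStevens_control h41sp hmod hGS hEsp⟩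

/-- **Bridge (integral cyclotomic road ⇒ crux), `h15`-FREE and K11-free**: PRINT {A235-twin `h41ns`, A236 `h41sp`,
modularity `hmod`} + MEMO {Greenberg–Stevens at `2`, split case only} + the ONE ∀-closed object T-mult-4-int ⟹
`MultiplicativeRankZeroTwoConverse`. (`multiplicativeRankZeroTwoConverse_of_multEisenstein_of_cotorsion` minus `h15`.)
[cite: GreenbergLNM1716, §4 pp. 112–113, Thm 1.4, §3 Prop. 3.7] [cite: MazurTateTeitelbaum1986Invent, §I.14 and §II.10] -/
theorem multiplicativeRankZeroTwoConverse_of_multEisenstein_of_control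
    (h41ns : thm41Analogue_charValue_rankZero_numberField_anyPrime_oddLocalDegree)
    (h41sp : thm41Analogue_charValue_rankZero_split_baseChange_anyPrime)
    (hmod : nonempty_modularParametrizationData)
    (hGS : ∀ (W : WeierstrassCurve ℚ) [W.IsElliptic] [W.IsGloballyMinimal],
      W.HasSplitMultiplicativeReductionAtPrime 2 → greenberg_stevens (W := W) (p := 2))
    (hEis : ∀ (W : WeierstrassCurve ℚ) [W.IsElliptic] [W.IsGloballyMinimal],
      ¬ W.HasCM → Mult W 2 → MultEisensteinDivisibilityAtTwo W) :
    MultiplicativeRankZeroTwoConverse :=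
  multiplicativeRankZeroTwoConverse_of_bySign_control h41ns h41sp hmod hGS
    (fun W _ _ hcm hmult _ ↦ hEis W hcm hmult) (fun W _ _ hcm hmult _ ↦ hEis W hcm hmult)

/-- **`h15`-FREE bridge with the object weakened from the converse side: T-mult-4-int on the finite-`Sel` locus, up to
isogeny** (`…_of_cotorsion_upToIsogeny` minus `h15`; isogeny invariance of `corank Sel_{2^∞}` and of `ord_{s=1} L`:
`analyticRank_eq_zero_of_isIsogenous_of_selmerCorank_two_eq_zero`).
[cite: GreenbergLNM1716, §4 pp. 112–113, Thm 1.4, §3 Prop. 3.7 and §1 pp. 54–57] [cite: Knapp1993, Thm. 11.67] -/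
theorem multiplicativeRankZeroTwoConverse_of_multEisenstein_of_control_upToIsogeny
    (h41ns : thm41Analogue_charValue_rankZero_numberField_anyPrime_oddLocalDegree)
    (h41sp : thm41Analogue_charValue_rankZero_split_baseChange_anyPrime)
    (hmod : nonempty_modularParametrizationData)
    (hGS : ∀ (W : WeierstrassCurve ℚ) [W.IsElliptic] [W.IsGloballyMinimal],
      W.HasSplitMultiplicativeReductionAtPrime 2 → greenberg_stevens (W := W) (p := 2))
    (hE : ∀ (W : WeierstrassCurve ℚ) [W.IsElliptic] [W.IsGloballyMinimal], ¬ W.HasCM → Mult W 2 →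
      Finite (W.selmerGroupPInfty 2) →
        ∃ (W' : WeierstrassCurve ℚ) (_ : W'.IsElliptic) (_ : W'.IsGloballyMinimal),
          IsIsogenous W W' ∧ Mult W' 2 ∧ MultEisensteinDivisibilityAtTwo W') :
    MultiplicativeRankZeroTwoConverse := by
  unfold MultiplicativeRankZeroTwoConverse
  intro W _ _ hcm hmult hsel
  have hSel : Finite (W.selmerGroupPInfty 2) :=
    (finite_selmerGroupPInfty_iff_selmerCorank_eq_zero W 2).2 hsel
  obtain ⟨W', _, _, hiso, hmult', hE'⟩ := hE W hcm hmult hSel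
  refine analyticRank_eq_zero_of_isIsogenous_of_selmerCorank_two_eq_zero hiso (fun hsel' ↦ ?_) hsel
  have hfin' : Finite (W'.selmerGroupPInfty 2) :=
    (finite_selmerGroupPInfty_iff_selmerCorank_eq_zero W' 2).2 hsel'
  by_cases hsp : W'.HasSplitMultiplicativeReductionAtPrime 2
  · exact (analyticRank_eq_zero_of_finite_selmer_split_two_of_multEisenstein W' (hGS W' hsp) h41sp
      hmod (isTorsion_two_of_finite_selmer_mult W' hmult' hfin') hE' hmult' hsp hfin').2
  · exact (analyticRank_eq_zero_of_selmerCorank_eq_zero_nonsplit_two_of_multEisenstein_control W' h41ns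
      hmod hE' hmult' hsp hsel').2

/-! ## §3 The served crux `MultTwoConverseOverKAtTwo` (item 19187) BY NAME, `h15`-free -/

/-- **The SERVED crux `MultTwoConverseOverKAtTwo` (item stmt-BirchSwinnertonDyer-19187) from the `h15`-free, K11-free
integral cyclotomic road**: the route's PUB child (`hP`) + PRINT {A235-twin, A236, modularity} + MEMO {Greenberg–Stevens at
a split `2`} + the ONE ∀-closed object T-mult-4-int ⟹ `MultTwoConverseOverKAtTwo`, through `19219 ⟹ 19187` mod PUB
(`multTwoConverseOverKAtTwo_of_multiplicativeRankZeroTwoConverse`). The 4th conjunct «Greenberg Thm. 1.5» of the line's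
published-inputs pack is no longer consumed. [cite: GreenbergLNM1716, §4 pp. 112–113, Thm 1.4, §3 Prop. 3.7]
[cite: Kato2004Asterisque, Cor. 14.3 (p. 235)] -/
theorem multTwoConverseOverKAtTwo_of_multEisenstein_of_control
    (hP : MultConversePublishedInputsAtTwo)
    (h41ns : thm41Analogue_charValue_rankZero_numberField_anyPrime_oddLocalDegree)
    (h41sp : thm41Analogue_charValue_rankZero_split_baseChange_anyPrime)
    (hmod : nonempty_modularParametrizationData)
    (hGS : ∀ (W : WeierstrassCurve ℚ) [W.IsElliptic] [W.IsGloballyMinimal],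
      W.HasSplitMultiplicativeReductionAtPrime 2 → greenberg_stevens (W := W) (p := 2))
    (hEis : ∀ (W : WeierstrassCurve ℚ) [W.IsElliptic] [W.IsGloballyMinimal],
      ¬ W.HasCM → Mult W 2 → MultEisensteinDivisibilityAtTwo W) :
    MultTwoConverseOverKAtTwo :=
  multTwoConverseOverKAtTwo_of_multiplicativeRankZeroTwoConverse hP
    (multiplicativeRankZeroTwoConverse_of_multEisenstein_of_control h41ns h41sp hmod hGS hEis)

end Summit.BirchSwinnertonDyer.BirchSwinnertonDyer.Theorems

end
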